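import Summits.NavierStokesRegularity.NavierStokesRegularity.Theorems.ExtremiserTransienceKStarAttainedConePotential
import Literature.Analysis.FluidPDE.SolenoidalTruncation
import HarnessLib

/-!
# Crux `ExtremiserTransience.NearExtremalTransience` (stmt-NavierStokesRegularity-21883), line `extremiser_liouville`,
# stub K1b — THE SOLENOIDAL TRUNCATION IS THE CURL OF THE CUT-OFF CONE POTENTIAL

`--supports stmt-NavierStokesRegularity-21883` (helper).  Author: prover seat `ns-el-k1b` (g2).

The tree's two divergence-free cut-offs of a field `V` coincide:
`solenoidalTruncation V R = curl (cutoff R · conePotential V)` for smooth divergence-free `V`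
(`solenoidalTruncation_eq_curl_cutoff_conePotential`).  Ingredients: `conePotential V x = (poincareField V x) × x`
(`conePotential_eq_cross_poincareField`), the Leibniz rule `curl (χ A) = χ curl A + curlCLM (Dχ ⊗ A)`, the identity
`curl (conePotential V) = V` (`KStar.curl_conePotential`) and the algebra `curlCLM (ℓ ⊗ (a × x)) = ℓ(x) a − ℓ(a) x`
(`curlCLM_smulRight_cross`).  USE: the first-variation functional of an extremiser of the stretching efficiency is
represented by a density on test fields of the form `curl η`, `η ∈ C^∞_c`; this identity makes the solenoidal truncations
of `w − c` (whose `H¹/H²` convergence the density leaf files establish) such test fields (`…ExtremiserLiouvillePlateau`).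

WHAT THIS IS NOT: vector calculus only; nothing here proves NS regularity. [folklore]
-/

noncomputable section

open Set Filter Topology MeasureTheory Metric Function
open scoped ENNReal NNReal Topology InnerProductSpace RealInnerProductSpace
open Literature.Analysis.FluidPDE Literature.Analysis

namespace Summit.NavierStokesRegularity.NavierStokesRegularity.Theorems

-- the problem directory repeats the summit name (`NavierStokesRegularity/NavierStokesRegularity`)
set_option linter.dupNamespace false

namespace ExtremiserLiouville

/-- `curlCLM (ℓ ⊗ (a × x)) = ℓ(x)·a − ℓ(a)·x` (the curl of the rank-one field `h ↦ ℓ(h) (a × x)` is `∇ℓ × (a × x)`,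
expanded by the triple-product rule). [folklore] -/
theorem curlCLM_smulRight_cross (ℓ : EuclideanSpace ℝ (Fin 3) →L[ℝ] ℝ) (a x : EuclideanSpace ℝ (Fin 3)) :
    curlCLM (ℓ.smulRight (cross a x)) = (ℓ x) • a - (ℓ a) • x := by
  have hx : x = ∑ j, x j • EuclideanSpace.single j (1 : ℝ) := by
    conv_lhs => rw [← (EuclideanSpace.basisFun (Fin 3) ℝ).sum_repr x]
    simp
  have ha : a = ∑ j, a j • EuclideanSpace.single j (1 : ℝ) := by
    conv_lhs => rw [← (EuclideanSpace.basisFun (Fin 3) ℝ).sum_repr a]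
    simp
  have hℓx : ℓ x = ∑ j, x j * ℓ (EuclideanSpace.single j 1) := by
    conv_lhs => rw [hx]
    simp [map_sum, map_smul]
  have hℓa : ℓ a = ∑ j, a j * ℓ (EuclideanSpace.single j 1) := by
    conv_lhs => rw [ha]
    simp [map_sum, map_smul]
  rw [hℓx, hℓa]
  ext i
  fin_cases i <;>
    simp [curlCLM, curlLM, cross, Fin.sum_univ_three, crossProduct] <;> ring

/-- `conePotential V x = (poincareField V x) × x`: the cross product with the fixed vector `x` commutes with the
`t`-integral. [folklore] -/
theorem conePotential_eq_cross_poincareField {V : EuclideanSpace ℝ (Fin 3) → EuclideanSpace ℝ (Fin 3)}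
    (hV : Continuous V) (x : EuclideanSpace ℝ (Fin 3)) :
    conePotential V x = cross (poincareField V x) x := by
  rw [conePotential, poincareField_apply]
  have hint : IntervalIntegrable (fun t : ℝ => t • V (t • x)) volume 0 1 :=
    ((continuous_id.smul (hV.comp (continuous_id.smul continuous_const))).intervalIntegrable _ _)
  have h := (crossCLM.flip x).intervalIntegral_comp_comm hint
  simp only [ContinuousLinearMap.flip_apply, crossCLM_apply] at h
  rw [← h]
  refine intervalIntegral.integral_congr fun t _ => ?_
  simp only [coneIntegrand_apply]
  rw [show cross (t • V (t • x)) x = crossCLM (t • V (t • x)) x from rfl, map_smul]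
  rfl

/-- **The solenoidal truncation is the curl of the cut-off cone potential**:
`solenoidalTruncation V R = curl (cutoff R · conePotential V)` for smooth divergence-free `V`. [folklore] -/
theorem solenoidalTruncation_eq_curl_cutoff_conePotential {V : EuclideanSpace ℝ (Fin 3) → EuclideanSpace ℝ (Fin 3)}
    (hV : ContDiff ℝ (⊤ : ℕ∞) V) (hdiv : VectorCalculus.IsDivFree V) (R : ℝ) :
    solenoidalTruncation V R = curl (fun y => cutoff R y • conePotential V y) := by
  funext x
  have hA : ContDiff ℝ (⊤ : ℕ∞) (conePotential V) := DepletionLadder.KStar.contDiff_conePotential hV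
  have hχd : DifferentiableAt ℝ (cutoff (E := EuclideanSpace ℝ (Fin 3)) R) x :=
    (contDiff_cutoff (n := 1) R).differentiable one_ne_zero x
  have hAd : DifferentiableAt ℝ (conePotential V) x := (hA.differentiable (by simp)) x
  rw [curl_smul hχd hAd, DepletionLadder.KStar.curl_conePotential hV hdiv x,
    conePotential_eq_cross_poincareField hV.continuous x, curlCLM_smulRight_cross, solenoidalTruncation]
  abel

end ExtremiserLiouville

end Summit.NavierStokesRegularity.NavierStokesRegularity.Theorems

end
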